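import Literature.AlgebraicGeometry.Motives.HodgeStructureDivisorClassesDirectSum
import HarnessLib

/-!
# The Picard number of a power: `ρ(H^{⊕k}) = k·ρ(H) + C(k,2)·dim_ℚ End_HS(H)` (Murty 1984 Lemma 3.3 in uniform form;
# `ρ(E^k) = k(k+1)/2` resp. `k²`), and `dim_ℚ Hom_HS(H^{⊕k}, H₀) = k·dim_ℚ Hom_HS(H, H₀)`

[topic AlgebraicGeometry/Motives]

Layer `Literature/AlgebraicGeometry/Motives`, lane `lit-hodgefound` (Track 2 foundations library; prover seat `lit-hodgefound-p34`,
generation 26, row g26-#8). THEOREMS ONLY (no `def`, no named fact, net debt `0`). Sequel of the seat's g26-#5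
`Motives/HodgeStructurePicardNumberDirectSum` (`ρ(H₁ ⊕ H₂) = ρ(H₁) + ρ(H₂) + dim_ℚ Hom_HS(H₁, H₂)`, odd weight, polarized) and g26-#6
`Motives/HodgeStructureDivisorClassesFunctoriality` (`dim Hdgᵖ(⋀ᵏ H)` is an isomorphism invariant), by induction on the index
type through the canonical isomorphisms of Hodge structures `H^{⊕ Option ι} ≅ H^{⊕ι} ⊕ H` and `H^{⊕ι} ≅ H^{⊕ι'}` (`ι ≃ ι'`), all
assembled from the tree's `Hom.piLift` / `Hom.piProj` / `Hom.prodLift` (no new definition).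

## The sources, verbatim

K. Hulek, R. Laface, *On the Picard numbers of abelian varieties* (2019) [HulekLaface2019PicardNumbersAV] (held text
`paper:arxiv-1703.05882`, chunk p0006): "**Proposition 2.4** (Lemma 3.3 of [Murty 1984]). Let `A` be a simple abelian variety.
Set `e := [K : ℚ]`, `d² := [F : K]`. Then, for `k ≥ 1`, one has `ρ(A^k) = ½ek(k+1)` (Type I), `ek(2k+1)` (Type II), `ek(2k−1)`
(Type III), `½ed²k²` (Type IV)", reformulated in the proof of Cor. 2.5 as "`ρ(A^k) = ½ρk(k+1)` (I), `⅓ρk(2k+1)` (II), `ρk(2k−1)` (III),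
`ρk²` (IV)" with `ρ = ρ(A) = e, 3e, e, ½ed²`; and "In the case of a self-product of an elliptic curve this gives the well known
`ρ(E^k) = ½k(k+1)` (`E` has no CM), `k²` (`E` has CM)". All four cases are the single formula
**`ρ(A^k) = k·ρ(A) + C(k,2)·dim_ℚ End⁰(A)`** (`dim_ℚ End⁰(A) = e, 4e, 4e, ed²` in the four types: `ek + ½k(k−1)e = ½ek(k+1)`,
`3ek + 2ek(k−1) = ek(2k+1)`, `ek + 2ek(k−1) = ek(2k−1)`, `½ed²k + ½ed²k(k−1) = ½ed²k²`), which is what is proved here, for every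
polarized `ℚ`-Hodge structure of odd weight (simple or not): by §2.1 loc. cit. (Prop. 2.2 / Cor. 2.3, the seat's g26-#5)
`ρ(X₁ × X₂) = ρ(X₁) + ρ(X₂) + rank Hom(X₁, X₂)` and `Hom(A^k, A) = End⁰(A)^k`. V. K. Murty, *Exceptional Hodge classes on certain
abelian varieties*, Math. Ann. 268 (1984) [Murty1984], Lemma 3.3 (cited through Hulek–Laface Prop. 2.4; acq-05538 open for the
original). H. Lange, *Abelian Varieties over the Complex Numbers* (2023) [Lange2023AbelianVarietiesComplex], §2.4.2 Prop. 2.4.12 (a).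

## What is PROVED (`H^{⊕ι} = HodgeStructure.pi fun _ : ι ↦ H`, `ι` a finite type; `ρ(H) = dim_ℚ Hdgⁿ(⋀² H)`)

* §1 `Hom` OUT OF A DIRECT SUM (any weight): `dim Hom_HS(H₁ ⊕ H₂, H₀) = dim Hom_HS(H₁, H₀) + dim Hom_HS(H₂, H₀)` (`finrank_hom_prod_eq`,
  through `Φ ↦ (Φ ∘ in₁, Φ ∘ in₂)`, inverse `Hom.prodDesc`); `dim Hom_HS(A', H₀) = dim Hom_HS(A, H₀)` for a bijective morphism
  `A → A'` (`Hom.finrank_hom_eq_of_bijective`).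
* §2 THE CANONICAL ISOMORPHISMS `H^{⊕ι} → H^{⊕ι'}` (`ι ≃ ι'`) and `H^{⊕ Option ι} → H^{⊕ι} ⊕ H` are bijective morphisms of Hodge
  structures (`piLift_piProj_equiv_bijective`, `piOptionToProd_bijective`) and the induced equalities of `dim Hdgᵖ(⋀ᵏ ·)` and
  `dim Hom_HS(·, H₀)`; (private) over an empty index type `H^{⊕ι}` has no Hodge classes in `⋀ᵏ`, `k ≠ 0`, and no non-zero morphisms.
* §3 **`dim_ℚ Hom_HS(H^{⊕ι}, H₀) = |ι| · dim_ℚ Hom_HS(H, H₀)`** (`finrank_hom_pi_const_eq`, any weight).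
* §4 **`ρ(H^{⊕ι}) = |ι|·ρ(H) + C(|ι|, 2)·dim_ℚ E_φ(H)`** for polarized `H` of odd weight (`Polarization.finrank_hodgeClasses_two_pi_const`,
  Murty's Lemma 3.3 uniformly); corollaries: `E_φ(H) = ℚ ⟹ ρ(H^{⊕k}) = C(k+1, 2) = k(k+1)/2` ("`E` has no CM"; more generally
  "Type I with `e = 1`"), `ρ(H) = 1 ∧ dim E_φ(H) = 2 ⟹ ρ(H^{⊕k}) = k²` ("`E` has CM").

NOT here: Murty's type-by-type values of `ρ(A)` and `dim End⁰(A)` (Albert classification inputs); `Hom` INTO a direct sum.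

## References

* [HulekLaface2019PicardNumbersAV] K. Hulek, R. Laface, *On the Picard numbers of abelian varieties*, Ann. Sc. Norm. Super. Pisa
  (2019), §2.1 Prop. 2.2, Cor. 2.3; §2.2 Prop. 2.4 (= Murty 1984 Lemma 3.3), Cor. 2.5 and the display `ρ(E^k)`.
* [Murty1984] V. K. Murty, *Exceptional Hodge classes on certain abelian varieties*, Math. Ann. 268 (1984) 197–206, Lemma 3.3.
* [Lange2023AbelianVarietiesComplex] H. Lange, *Abelian Varieties over the Complex Numbers*, Springer (2023), §2.4.2 Prop. 2.4.12.
* [DeligneHodgeII1971] P. Deligne, *Théorie de Hodge II* (1971), 2.1 (the additive category of Hodge structures).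
-/

noncomputable section

open scoped TensorProduct

namespace Literature.AlgebraicGeometry.Motives

namespace HodgeStructure

universe u v w

/-! ## §1 Morphisms out of a direct sum, and transport along isomorphisms -/

section HomSpaces

variable {V : Type u} [AddCommGroup V] [Module ℚ V] {W : Type u} [AddCommGroup W] [Module ℚ W]
  {V₀ : Type u} [AddCommGroup V₀] [Module ℚ V₀] {n : ℤ}

/-- `Hom_HS(H₁, H₂)` is finite-dimensional over `ℚ` for finite-dimensional carriers (a subspace of `Hom_ℚ(V, W)`). [folklore] -/
private theorem Hom.moduleFinite [Module.Finite ℚ V] [Module.Finite ℚ W] (H₁ : HodgeStructure V n) (H₂ : HodgeStructure W n) :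
    Module.Finite ℚ (Hom H₁ H₂) :=
  Module.Finite.of_injective ({ toFun := Hom.toLinearMap, map_add' := fun _ _ ↦ rfl, map_smul' := fun _ _ ↦ rfl } :
    Hom H₁ H₂ →ₗ[ℚ] (V →ₗ[ℚ] W)) Hom.toLinearMap_injective

/-- **`dim_ℚ Hom_HS(H₁ ⊕ H₂, H₀) = dim_ℚ Hom_HS(H₁, H₀) + dim_ℚ Hom_HS(H₂, H₀)`** — a morphism out of a direct sum is the pair of
its restrictions `(Φ ∘ in₁, Φ ∘ in₂)`, inverse `(f, g) ↦ f ∘ pr₁ + g ∘ pr₂` (the tree's `Hom.prodDesc`): Hodge structures form an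
additive category. [cite: DeligneHodgeII1971, 2.1] [cite: HulekLaface2019PicardNumbersAV, §2.1 Prop. 2.2 (proof: `Hom` of a product)] -/
theorem finrank_hom_prod_eq [Module.Finite ℚ V] [Module.Finite ℚ W] [Module.Finite ℚ V₀] (H₁ : HodgeStructure V n)
    (H₂ : HodgeStructure W n) (H₀ : HodgeStructure V₀ n) :
    Module.finrank ℚ (Hom (H₁.prod H₂) H₀) = Module.finrank ℚ (Hom H₁ H₀) + Module.finrank ℚ (Hom H₂ H₀) := by
  haveI := Hom.moduleFinite H₁ H₀
  haveI := Hom.moduleFinite H₂ H₀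
  let e : Hom (H₁.prod H₂) H₀ ≃ₗ[ℚ] Hom H₁ H₀ × Hom H₂ H₀ :=
    { toFun := fun Φ ↦ (Φ.comp (Hom.prodInl H₁ H₂), Φ.comp (Hom.prodInr H₁ H₂))
      invFun := fun fg ↦ Hom.prodDesc fg.1 fg.2
      map_add' := fun Φ Ψ ↦ Prod.ext (Hom.ext (LinearMap.add_comp _ _ _)) (Hom.ext (LinearMap.add_comp _ _ _))
      map_smul' := fun c Φ ↦ Prod.ext (Hom.ext (LinearMap.smul_comp _ _ _)) (Hom.ext (LinearMap.smul_comp _ _ _))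
      left_inv := fun Φ ↦ Hom.ext (by
        show (Hom.prodDesc (Φ.comp (Hom.prodInl H₁ H₂)) (Φ.comp (Hom.prodInr H₁ H₂))).toLinearMap = Φ.toLinearMap
        rw [Hom.prodDesc_toLinearMap, Hom.comp_toLinearMap, Hom.comp_toLinearMap, Hom.prodInl_toLinearMap,
          Hom.prodInr_toLinearMap, ← LinearMap.comp_coprod, LinearMap.coprod_inl_inr, LinearMap.comp_id])
      right_inv := fun fg ↦ Prod.ext (Hom.ext (LinearMap.coprod_inl _ _)) (Hom.ext (LinearMap.coprod_inr _ _)) }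
  rw [e.finrank_eq, Module.finrank_prod]

/-- **`dim_ℚ Hom_HS(A', H₀) = dim_ℚ Hom_HS(A, H₀)` for a bijective morphism `g : A → A'`** (an isomorphism of Hodge structures,
the tree's `Hom.inverse`): `Φ ↦ Φ ∘ g`, inverse `Ψ ↦ Ψ ∘ g⁻¹`. [cite: VoisinHodgeI2002, §7.3.1 Lemma 7.23] -/
theorem Hom.finrank_hom_eq_of_bijective {A : HodgeStructure V n} {A' : HodgeStructure W n} (g : Hom A A')
    (hg : Function.Bijective g.toLinearMap) (H₀ : HodgeStructure V₀ n) :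
    Module.finrank ℚ (Hom A' H₀) = Module.finrank ℚ (Hom A H₀) :=
  LinearEquiv.finrank_eq
    { toFun := fun Φ ↦ Φ.comp g
      invFun := fun Ψ ↦ Ψ.comp (g.inverse hg)
      map_add' := fun _ _ ↦ Hom.ext (LinearMap.add_comp _ _ _)
      map_smul' := fun _ _ ↦ Hom.ext (LinearMap.smul_comp _ _ _)
      left_inv := fun Φ ↦ Hom.ext (by
        rw [Hom.comp_toLinearMap, Hom.comp_toLinearMap, LinearMap.comp_assoc, ← Hom.comp_toLinearMap,
          Hom.comp_inverse]
        exact LinearMap.comp_id _)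
      right_inv := fun Ψ ↦ Hom.ext (by
        rw [Hom.comp_toLinearMap, Hom.comp_toLinearMap, LinearMap.comp_assoc, ← Hom.comp_toLinearMap,
          Hom.inverse_comp]
        exact LinearMap.comp_id _) }

end HomSpaces

/-! ## §2 The canonical isomorphisms `H^{⊕ι} ≅ H^{⊕ι'}` and `H^{⊕ Option ι} ≅ H^{⊕ι} ⊕ H`; the empty power -/

section Powers

variable {V : Type u} [AddCommGroup V] [Module ℚ V] {V₀ : Type u} [AddCommGroup V₀] [Module ℚ V₀] {n : ℤ}
  (H : HodgeStructure V n) (H₀ : HodgeStructure V₀ n)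

/-- **Reindexing a power along `σ : ι ≃ ι'` is a bijective morphism `H^{⊕ι} → H^{⊕ι'}`** (`x ↦ x ∘ σ⁻¹`, the morphism
`Hom.piLift (j' ↦ pr_{σ⁻¹ j'})`; the same map as the tree's `Hom.piReindex` of `Motives/KugaSatakeOfOrthogonalSummand`, restated on
`Hom.piLift`/`Hom.piProj` so that this file does not import the Kuga–Satake cone). [cite: DeligneHodgeII1971, 2.1] -/
theorem piLift_piProj_equiv_bijective {ι : Type} [Fintype ι] [DecidableEq ι] {ι' : Type} [Fintype ι'] [DecidableEq ι'] (σ : ι ≃ ι') :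
    Function.Bijective
      (Hom.piLift fun j' : ι' ↦ Hom.piProj (fun _ : ι ↦ H) (σ.symm j') :
        Hom (HodgeStructure.pi fun _ : ι ↦ H) (HodgeStructure.pi fun _ : ι' ↦ H)).toLinearMap := by
  have h : ⇑(Hom.piLift fun j' : ι' ↦ Hom.piProj (fun _ : ι ↦ H) (σ.symm j') :
      Hom (HodgeStructure.pi fun _ : ι ↦ H) (HodgeStructure.pi fun _ : ι' ↦ H)).toLinearMap =
        ⇑(Equiv.piCongrLeft' (fun _ : ι ↦ V) σ) := by
    funext x
    rfl
  rw [h]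
  exact (Equiv.piCongrLeft' (fun _ : ι ↦ V) σ).bijective

/-- **`H^{⊕ Option ι} → H^{⊕ι} ⊕ H`, `x ↦ ((x (some j))_j, x none)`, is a bijective morphism** (the morphism
`Hom.prodLift (Hom.piLift (j ↦ pr_{some j})) pr_{none}`; inverse `(y, v) ↦ (none ↦ v, some j ↦ y j)`). [cite: DeligneHodgeII1971, 2.1] -/
theorem piOptionToProd_bijective {ι : Type} [Fintype ι] [DecidableEq ι] [DecidableEq (Option ι)] :
    Function.Bijective
      (Hom.prodLift (Hom.piLift fun j : ι ↦ Hom.piProj (fun _ : Option ι ↦ H) (some j))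
          (Hom.piProj (fun _ : Option ι ↦ H) none) :
        Hom (HodgeStructure.pi fun _ : Option ι ↦ H) ((HodgeStructure.pi fun _ : ι ↦ H).prod H)).toLinearMap := by
  set f := (Hom.prodLift (Hom.piLift fun j : ι ↦ Hom.piProj (fun _ : Option ι ↦ H) (some j))
    (Hom.piProj (fun _ : Option ι ↦ H) none) :
      Hom (HodgeStructure.pi fun _ : Option ι ↦ H) ((HodgeStructure.pi fun _ : ι ↦ H).prod H)).toLinearMap with hf
  have happly : ∀ x : Option ι → V, f x = (fun j ↦ x (some j), x none) := fun x ↦ rfl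
  refine Function.bijective_iff_has_inverse.2 ⟨fun yv o ↦ Option.elim o yv.2 yv.1, fun x ↦ ?_, fun yv ↦ ?_⟩
  · rw [happly]
    funext o
    cases o <;> rfl
  · rw [happly]
    rfl

/-- `dim Hdgᵖ(⋀ᵏ H^{⊕ι}) = dim Hdgᵖ(⋀ᵏ H^{⊕ι'})` for `ι ≃ ι'` (transport along the reindexing isomorphism, g26-#6).
[cite: DeligneHodgeII1971, 2.1] -/
theorem finrank_hodgeClasses_exteriorPower_pi_congr {ι : Type} [Fintype ι] [DecidableEq ι] {ι' : Type} [Fintype ι']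
    [DecidableEq ι'] (σ : ι ≃ ι') (k : ℕ) (p : ℤ) :
    Module.finrank ℚ (((HodgeStructure.pi fun _ : ι ↦ H).exteriorPower k).hodgeClasses p) =
      Module.finrank ℚ (((HodgeStructure.pi fun _ : ι' ↦ H).exteriorPower k).hodgeClasses p) :=
  (Hom.piLift fun j' : ι' ↦ Hom.piProj (fun _ : ι ↦ H) (σ.symm j')).finrank_hodgeClasses_exteriorPower_eq_of_bijective
    (piLift_piProj_equiv_bijective H σ) k p

/-- `dim_ℚ Hom_HS(H^{⊕ι}, H₀) = dim_ℚ Hom_HS(H^{⊕ι'}, H₀)` for `ι ≃ ι'`. [cite: DeligneHodgeII1971, 2.1] -/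
theorem finrank_hom_pi_congr {ι : Type} [Fintype ι] [DecidableEq ι] {ι' : Type} [Fintype ι'] [DecidableEq ι'] (σ : ι ≃ ι') :
    Module.finrank ℚ (Hom (HodgeStructure.pi fun _ : ι ↦ H) H₀) = Module.finrank ℚ (Hom (HodgeStructure.pi fun _ : ι' ↦ H) H₀) :=
  (Hom.finrank_hom_eq_of_bijective _ (piLift_piProj_equiv_bijective H σ) H₀).symm

/-- `dim Hdgᵖ(⋀ᵏ H^{⊕ Option ι}) = dim Hdgᵖ(⋀ᵏ (H^{⊕ι} ⊕ H))` (transport along `H^{⊕ Option ι} ≅ H^{⊕ι} ⊕ H`, g26-#6).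
[cite: DeligneHodgeII1971, 2.1] -/
theorem finrank_hodgeClasses_exteriorPower_pi_option {ι : Type} [Fintype ι] [DecidableEq ι] [DecidableEq (Option ι)]
    (k : ℕ) (p : ℤ) :
    Module.finrank ℚ (((HodgeStructure.pi fun _ : Option ι ↦ H).exteriorPower k).hodgeClasses p) =
      Module.finrank ℚ ((((HodgeStructure.pi fun _ : ι ↦ H).prod H).exteriorPower k).hodgeClasses p) :=
  (Hom.prodLift (Hom.piLift fun j : ι ↦ Hom.piProj (fun _ : Option ι ↦ H) (some j))
    (Hom.piProj (fun _ : Option ι ↦ H) none)).finrank_hodgeClasses_exteriorPower_eq_of_bijective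
      (piOptionToProd_bijective H) k p

/-- `dim_ℚ Hom_HS(H^{⊕ Option ι}, H₀) = dim_ℚ Hom_HS(H^{⊕ι} ⊕ H, H₀)`. [cite: DeligneHodgeII1971, 2.1] -/
theorem finrank_hom_pi_option {ι : Type} [Fintype ι] [DecidableEq ι] [DecidableEq (Option ι)] :
    Module.finrank ℚ (Hom (HodgeStructure.pi fun _ : Option ι ↦ H) H₀) =
      Module.finrank ℚ (Hom ((HodgeStructure.pi fun _ : ι ↦ H).prod H) H₀) :=
  (Hom.finrank_hom_eq_of_bijective _ (piOptionToProd_bijective H) H₀).symm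

/-- Over an EMPTY index type the power `H^{⊕ι}` (on the zero space) has no Hodge classes in `⋀ᵏ`, `k ≠ 0`:
`dim Hdgᵖ(⋀ᵏ H^{⊕∅}) = 0`. [folklore] -/
private theorem finrank_hodgeClasses_exteriorPower_pi_eq_zero_of_isEmpty {ι : Type} [Fintype ι] [DecidableEq ι] [IsEmpty ι]
    [Module.Finite ℚ V] {k : ℕ} (hk : k ≠ 0) (p : ℤ) :
    Module.finrank ℚ (((HodgeStructure.pi fun _ : ι ↦ H).exteriorPower k).hodgeClasses p) = 0 := by
  have h0 : Module.finrank ℚ (⋀[ℚ]^k (ι → V)) = 0 := by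
    rw [exteriorPower.finrank_eq, Module.finrank_pi_fintype, Finset.univ_eq_empty, Finset.sum_empty,
      Nat.choose_eq_zero_of_lt (Nat.pos_of_ne_zero hk)]
  have h1 := Submodule.finrank_le (((HodgeStructure.pi fun _ : ι ↦ H).exteriorPower k).hodgeClasses p)
  omega

/-- Over an EMPTY index type every morphism `H^{⊕∅} → H₀` is zero: `dim_ℚ Hom_HS(H^{⊕∅}, H₀) = 0`. [folklore] -/
private theorem finrank_hom_pi_eq_zero_of_isEmpty {ι : Type} [Fintype ι] [DecidableEq ι] [IsEmpty ι] :
    Module.finrank ℚ (Hom (HodgeStructure.pi fun _ : ι ↦ H) H₀) = 0 := by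
  haveI : Subsingleton (Hom (HodgeStructure.pi fun _ : ι ↦ H) H₀) :=
    ⟨fun a b ↦ Hom.ext (LinearMap.ext fun x ↦ by rw [Subsingleton.elim x 0, map_zero, map_zero])⟩
  exact Module.finrank_zero_of_subsingleton

end Powers

/-! ## §3 `dim_ℚ Hom_HS(H^{⊕ι}, H₀) = |ι| · dim_ℚ Hom_HS(H, H₀)` -/

section HomPi

variable {V : Type u} [AddCommGroup V] [Module ℚ V] [Module.Finite ℚ V] {V₀ : Type u} [AddCommGroup V₀] [Module ℚ V₀]
  [Module.Finite ℚ V₀] {n : ℤ} (H : HodgeStructure V n) (H₀ : HodgeStructure V₀ n)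

/-- **`dim_ℚ Hom_HS(H^{⊕ι}, H₀) = |ι| · dim_ℚ Hom_HS(H, H₀)`** ("`Hom(A^k, B) = Hom(A, B)^k`"), by induction on the index type:
`H^{⊕ Option ι} ≅ H^{⊕ι} ⊕ H` and §1. [cite: DeligneHodgeII1971, 2.1] [cite: HulekLaface2019PicardNumbersAV, §2.2 Prop. 2.4 (= Murty 1984 Lemma 3.3)] -/
theorem finrank_hom_pi_const_eq {ι : Type} [Fintype ι] [DecidableEq ι] :
    Module.finrank ℚ (Hom (HodgeStructure.pi fun _ : ι ↦ H) H₀) = Fintype.card ι * Module.finrank ℚ (Hom H H₀) := by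
  have key := Fintype.induction_empty_option
    (P := fun (α : Type) [Fintype α] ↦ ∀ [DecidableEq α],
      Module.finrank ℚ (Hom (HodgeStructure.pi fun _ : α ↦ H) H₀) = Fintype.card α * Module.finrank ℚ (Hom H H₀))
    (fun α β _ σ hα ↦ by
      intro _
      letI : Fintype α := Fintype.ofEquiv β σ.symm
      letI : DecidableEq α := fun a b ↦ decidable_of_iff (σ a = σ b) σ.injective.eq_iff
      rw [← Fintype.card_congr σ, ← hα, finrank_hom_pi_congr H H₀ σ])
    (by
      intro _
      rw [finrank_hom_pi_eq_zero_of_isEmpty H H₀, Fintype.card_eq_zero, zero_mul])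
    (fun α _ hα ↦ by
      intro _
      letI : DecidableEq α := fun a b ↦ decidable_of_iff (some a = some b) Option.some_inj
      rw [finrank_hom_pi_option H H₀, finrank_hom_prod_eq, hα, Fintype.card_option]
      ring) ι
  exact key

end HomPi

/-! ## §4 `ρ(H^{⊕ι}) = |ι|·ρ(H) + C(|ι|,2)·dim_ℚ E_φ(H)` (Murty's Lemma 3.3, uniform form) -/

section PicardNumber

/-- `C(k+1, 2) = k + C(k, 2)` (Pascal). [folklore] -/
private theorem choose_two_succ (k : ℕ) : (k + 1).choose 2 = k + k.choose 2 := by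
  have h := Nat.choose_succ_succ' k 1
  simp only [Nat.reduceAdd, Nat.choose_one_right] at h
  exact h

/-- `k + 2·C(k,2) = k²`. [folklore] -/
private theorem add_two_mul_choose_two_eq_sq (k : ℕ) : k + 2 * k.choose 2 = k ^ 2 := by
  induction k with
  | zero => simp
  | succ k ih =>
    rw [choose_two_succ]
    nlinarith [ih]


variable {V : Type u} [AddCommGroup V] [Module ℚ V] [Module.Finite ℚ V] {n : ℤ} {H : HodgeStructure V n} (Q : Polarization H)

include Q in
/-- **`ρ(H^{⊕ι}) = |ι|·ρ(H) + C(|ι|, 2)·dim_ℚ Hom_HS(H, H)`** for a polarized `ℚ`-Hodge structure of odd weight — Murty's Lemma 3.3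
"`ρ(A^k) = ½ek(k+1), ek(2k+1), ek(2k−1), ½ed²k²`" (Types I–IV) in the uniform form `k·ρ(A) + C(k,2)·dim End⁰(A)`, for every
(not necessarily simple) `A`: induction on `ι` through `H^{⊕ Option ι} ≅ H^{⊕ι} ⊕ H`, `ρ(H₁ ⊕ H₂) = ρ(H₁) + ρ(H₂) + dim Hom(H₁, H₂)`
(g26-#5) and `dim Hom(H^{⊕ι}, H) = |ι| dim Hom(H, H)` (§3), with `C(k+1, 2) = C(k, 2) + k`.
[cite: HulekLaface2019PicardNumbersAV, §2.2 Prop. 2.4 (= Murty 1984 Lemma 3.3) and §2.1 Cor. 2.3] [cite: Murty1984, Lemma 3.3]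
[cite: Lange2023AbelianVarietiesComplex, §2.4.2 Prop. 2.4.12 (a) (chunk p0118)] -/
theorem Polarization.finrank_hodgeClasses_two_pi_const_eq_of_hom (hn : Odd n) {ι : Type} [Fintype ι] [DecidableEq ι] :
    Module.finrank ℚ (((HodgeStructure.pi fun _ : ι ↦ H).exteriorPower 2).hodgeClasses n) =
      Fintype.card ι * Module.finrank ℚ ((H.exteriorPower 2).hodgeClasses n) +
        (Fintype.card ι).choose 2 * Module.finrank ℚ (Hom H H) := by
  have key := Fintype.induction_empty_option
    (P := fun (α : Type) [Fintype α] ↦ ∀ [DecidableEq α],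
      Module.finrank ℚ (((HodgeStructure.pi fun _ : α ↦ H).exteriorPower 2).hodgeClasses n) =
        Fintype.card α * Module.finrank ℚ ((H.exteriorPower 2).hodgeClasses n) +
          (Fintype.card α).choose 2 * Module.finrank ℚ (Hom H H))
    (fun α β _ σ hα ↦ by
      intro _
      letI : Fintype α := Fintype.ofEquiv β σ.symm
      letI : DecidableEq α := fun a b ↦ decidable_of_iff (σ a = σ b) σ.injective.eq_iff
      rw [← Fintype.card_congr σ, ← hα, finrank_hodgeClasses_exteriorPower_pi_congr H σ 2 n])
    (by
      intro _
      rw [finrank_hodgeClasses_exteriorPower_pi_eq_zero_of_isEmpty H two_ne_zero n, Fintype.card_eq_zero, zero_mul,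
        Nat.choose_eq_zero_of_lt (by norm_num : 0 < 2), zero_mul, add_zero])
    (fun α _ hα ↦ by
      intro _
      letI : DecidableEq α := fun a b ↦ decidable_of_iff (some a = some b) Option.some_inj
      rw [finrank_hodgeClasses_exteriorPower_pi_option H 2 n, (Polarization.pi fun _ : α ↦ Q).finrank_hodgeClasses_two_prod Q hn,
        hα, finrank_hom_pi_const_eq H H, Fintype.card_option, choose_two_succ]
      ring) ι
  exact key

include Q in
/-- **Murty's Lemma 3.3, uniform form: `ρ(H^{⊕ι}) = |ι|·ρ(H) + C(|ι|, 2)·dim_ℚ E_φ(H)`** (polarized, odd weight; `E_φ(H) = H.endAlg`,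
`dim E_φ = dim Hom_HS(H, H)`). [cite: HulekLaface2019PicardNumbersAV, §2.2 Prop. 2.4 (= Murty 1984 Lemma 3.3)] [cite: Murty1984, Lemma 3.3] -/
theorem Polarization.finrank_hodgeClasses_two_pi_const (hn : Odd n) {ι : Type} [Fintype ι] [DecidableEq ι] :
    Module.finrank ℚ (((HodgeStructure.pi fun _ : ι ↦ H).exteriorPower 2).hodgeClasses n) =
      Fintype.card ι * Module.finrank ℚ ((H.exteriorPower 2).hodgeClasses n) +
        (Fintype.card ι).choose 2 * Module.finrank ℚ H.endAlg := by
  rw [Q.finrank_hodgeClasses_two_pi_const_eq_of_hom hn, finrank_endAlg_eq_finrank_hom H]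

include Q in
/-- **`E_φ(H) = ℚ ⟹ ρ(H^{⊕k}) = C(k+1, 2) = k(k+1)/2`** (polarized, odd weight, `V ≠ 0`): "`ρ(E^k) = ½k(k+1)` (`E` has no CM)" and,
with `e = 1`, Murty's Type I value `½ek(k+1)` — here for every `H` with `End_HS(H) = ℚ` (`ρ(H) = 1`, g26-#3).
[cite: HulekLaface2019PicardNumbersAV, §2.2 display `ρ(E^k)` and Prop. 2.4] [cite: Murty1984, Lemma 3.3] -/
theorem Polarization.finrank_hodgeClasses_two_pi_const_of_endAlg_eq_bot [Nontrivial V] (hn : Odd n) (hE : H.endAlg = ⊥)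
    {ι : Type} [Fintype ι] [DecidableEq ι] :
    Module.finrank ℚ (((HodgeStructure.pi fun _ : ι ↦ H).exteriorPower 2).hodgeClasses n) = (Fintype.card ι + 1).choose 2 := by
  rw [Q.finrank_hodgeClasses_two_pi_const hn, Q.finrank_hodgeClasses_two_eq_one_of_endAlg_eq_bot hn hE, hE,
    Subalgebra.finrank_bot, mul_one, mul_one, ← choose_two_succ]

include Q in
/-- **`ρ(H) = 1`, `dim_ℚ E_φ(H) = 2 ⟹ ρ(H^{⊕k}) = k²`** (polarized, odd weight): "`ρ(E^k) = k²` (`E` has CM)" — an elliptic curve with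
complex multiplication has `End⁰(E) = K` imaginary quadratic and `ρ(E) = 1`. [cite: HulekLaface2019PicardNumbersAV, §2.2 display `ρ(E^k)`]
[cite: Murty1984, Lemma 3.3] -/
theorem Polarization.finrank_hodgeClasses_two_pi_const_of_finrank_endAlg_eq_two (hn : Odd n)
    (hρ : Module.finrank ℚ ((H.exteriorPower 2).hodgeClasses n) = 1) (hE : Module.finrank ℚ H.endAlg = 2)
    {ι : Type} [Fintype ι] [DecidableEq ι] :
    Module.finrank ℚ (((HodgeStructure.pi fun _ : ι ↦ H).exteriorPower 2).hodgeClasses n) = Fintype.card ι ^ 2 := by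
  rw [Q.finrank_hodgeClasses_two_pi_const hn, hρ, hE, mul_one, mul_comm, add_two_mul_choose_two_eq_sq]

include Q in
/-- **`|ι|·ρ(H) ≤ ρ(H^{⊕ι})`** (polarized, odd weight): the exterior pull-backs of the divisor classes of the factors are independent
(g26-#7), the excess being `C(|ι|, 2)·dim_ℚ E_φ(H)`. [cite: HulekLaface2019PicardNumbersAV, §2.1 Prop. 2.2 ("always yields an injective map")] -/
theorem Polarization.card_mul_finrank_hodgeClasses_two_le_pi_const (hn : Odd n) {ι : Type} [Fintype ι] [DecidableEq ι] :
    Fintype.card ι * Module.finrank ℚ ((H.exteriorPower 2).hodgeClasses n) ≤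
      Module.finrank ℚ (((HodgeStructure.pi fun _ : ι ↦ H).exteriorPower 2).hodgeClasses n) := by
  rw [Q.finrank_hodgeClasses_two_pi_const hn]
  exact Nat.le_add_right _ _

end PicardNumber

end HodgeStructure

end Literature.AlgebraicGeometry.Motives

end
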